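import Summits.Ventures.QEC.Census.CertBZPlaneSeg2
import Summits.Ventures.QEC.Census.BB.A1s_n186_k10_42ba7993.Cert
import HarnessLib

/-!
# `A1s_n186_k10_42ba7993` — side Z lane FAMILIES, packed module 2/42 (qec-search-10 g4 packfam.py: parts BZPlaneFamZ0m0p1;
# Σ lanes 10958314, 4 theorems) at tier KERNEL — type-01 lane engine δ (`Plane.segOK` / `Plane.seg2OK`, Census/CertBZPlaneSeg2.lean);
# assembled by the block files `BZPlaneBlkZP*.lean`. First part's header:
# # `A1s_n186_k10_42ba7993` — certificate `28a8c3e9cd9695fa…`, side Z, block 0, matrix 0 (depth 5, 93 rows): lane FAMILIES part 2/2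
# # (4 theorems, Σ lanes 10958314) at tier KERNEL — type-01 lane engine δ (`Plane.segOK` one-level segments for largest rows `< 65`;
# # per larger row a singleton + `Plane.seg2OK` second-row ranges, Census/CertBZPlaneSeg2.lean); assembled by `BZPlaneBlkZ00.lean` (qec-search-10 g3 emit_bbrow.py)
-/

set_option autoImplicit false
set_option Elab.async false

namespace Summit.Ventures.QEC.Census.A1s_n186_k10_42ba7993

open Summit.Ventures.QEC.Census Summit.Ventures.QEC.Census.Plane

set_option maxHeartbeats 400000000 in
/-- Block 0, matrix 0: largest row 89, second-largest in `[0, 89)`, ≤ 3 below — every such selection passes (2559195 lanes; KERNEL). -/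
theorem pseg2_0_0_24 : Plane.seg2OK 186 13 (A1s_n186_k10_42ba7993.cert.sideZ.found.map Prod.fst) (giRows (gbRows A1s_n186_k10_42ba7993.cert.HZ A1s_n186_k10_42ba7993.bzAutData.rcZ A1s_n186_k10_42ba7993.bzAutData.LZ A1s_n186_k10_42ba7993.bzAutBlockZ0) (A1s_n186_k10_42ba7993.bzAutBlockZ0.mats.getD 0 { T := [], A := [], t := 0 })) 5 89 0 89 4565 = true := by decide +kernel

set_option maxHeartbeats 400000000 in
/-- Block 0, matrix 0: largest row 90, second-largest in `[0, 90)`, ≤ 3 below — every such selection passes (2676765 lanes; KERNEL). -/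
theorem pseg2_0_0_25 : Plane.seg2OK 186 13 (A1s_n186_k10_42ba7993.cert.sideZ.found.map Prod.fst) (giRows (gbRows A1s_n186_k10_42ba7993.cert.HZ A1s_n186_k10_42ba7993.bzAutData.rcZ A1s_n186_k10_42ba7993.bzAutData.LZ A1s_n186_k10_42ba7993.bzAutBlockZ0) (A1s_n186_k10_42ba7993.bzAutBlockZ0.mats.getD 0 { T := [], A := [], t := 0 })) 5 90 0 90 4565 = true := by decide +kernel

set_option maxHeartbeats 400000000 in
/-- Block 0, matrix 0: largest row 91, second-largest in `[0, 91)`, ≤ 3 below — every such selection passes (2798341 lanes; KERNEL). -/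
theorem pseg2_0_0_26 : Plane.seg2OK 186 13 (A1s_n186_k10_42ba7993.cert.sideZ.found.map Prod.fst) (giRows (gbRows A1s_n186_k10_42ba7993.cert.HZ A1s_n186_k10_42ba7993.bzAutData.rcZ A1s_n186_k10_42ba7993.bzAutData.LZ A1s_n186_k10_42ba7993.bzAutBlockZ0) (A1s_n186_k10_42ba7993.bzAutBlockZ0.mats.getD 0 { T := [], A := [], t := 0 })) 5 91 0 91 4565 = true := by decide +kernel

set_option maxHeartbeats 400000000 in
/-- Block 0, matrix 0: largest row 92, second-largest in `[0, 92)`, ≤ 3 below — every such selection passes (2924013 lanes; KERNEL). -/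
theorem pseg2_0_0_27 : Plane.seg2OK 186 13 (A1s_n186_k10_42ba7993.cert.sideZ.found.map Prod.fst) (giRows (gbRows A1s_n186_k10_42ba7993.cert.HZ A1s_n186_k10_42ba7993.bzAutData.rcZ A1s_n186_k10_42ba7993.bzAutData.LZ A1s_n186_k10_42ba7993.bzAutBlockZ0) (A1s_n186_k10_42ba7993.bzAutBlockZ0.mats.getD 0 { T := [], A := [], t := 0 })) 5 92 0 92 4565 = true := by decide +kernel

end Summit.Ventures.QEC.Census.A1s_n186_k10_42ba7993
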